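import Summits.HodgeConjecture.HodgeCM.PerL34.ArchCOrbitSmooth_1

/-! PORT of `HodgeCM/PerL34/ArchCOrbitSmooth.lean` (HodgeCMPerL run 82) — part 2: continuation of `Summits.HodgeConjecture.HodgeCM.PerL34.ArchCOrbitSmooth_1` (split at a top-level declaration boundary by port_pkg.py; scope re-opened below; declarations unchanged). -/

-- port_pkg: scope re-opened for this part (file-level context, then the namespace/section stack open at the cut)
set_option autoImplicit false
noncomputable section
open scoped Topology
open Filter
namespace HodgeCM
namespace PerL34
namespace ArchC
open HodgeCM.Prior.Perl34File HodgeCM.Prior.Perl34File.Perl34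
section Bridge
open HodgeCM.PerL34.Fock HodgeCM.PerL34.Fock.PrintDict
variable {H HG CG G SK SigIdx SigIdxG : Type*}
variable [NormedAddCommGroup H] [InnerProductSpace ℂ H] [CompleteSpace H]
variable [NormedAddCommGroup HG] [InnerProductSpace ℂ HG] [CompleteSpace HG]
variable [NormedAddCommGroup CG] [NormedSpace ℂ CG]
variable [Group G] [TopologicalSpace G] [TopologicalSpace SK]
namespace FockSmoothBridge
variable {C : IsolationCore H HG CG G SK SigIdx SigIdxG} {D : TorusData C} {P : C4a.PointedCore C}

/-- **Fréchet-smooth bridge ⇒ scalar bridge** (KERNEL: `hFpt` from `smooth` through the bounded linear functional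
Φ ↦ 𝒯_Φ(v)(g) — `hasDerivAt_pointValue_of_tendsto_slope`). -/
def toScalarBridge (B : FockSmoothBridge C D P) : FockScalarBridge C D P :=
  letI : AddCommGroup SK := B.instSKacg
  letI : Module ℂ SK := B.instSKmod
  { pl := B.pl
    ιT := B.ιT
    w := B.w
    w_norm := B.w_norm
    w_loc := B.w_loc
    instSKacg := B.instSKacg
    instSKmod := B.instSKmod
    TΦc_add := B.TΦc_add
    TΦc_smul := B.TΦc_smul
    cont := B.cont
    FinIdx := B.FinIdx
    ins := B.ins
    dense := B.dense
    omg_ins := B.omg_ins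
    invariance := B.invariance
    ιR := B.ιR
    XR := B.XR
    e := B.e
    ladder_span := B.ladder_span
    hFpt := fun j f φ p v =>
      hasDerivAt_pointValue_of_tendsto_slope B.TΦc_add B.TΦc_smul B.cont
        (γ := fun s => C.omg (B.e j s) (B.ins f φ)) (B.smooth j f φ) p v
    wOccurs_of_eigenvector := B.wOccurs_of_eigenvector }

/-- (Ported verbatim from the HodgeCMPerL package; no docstring in the source.) -/
theorem toScalarBridge_pl (B : FockSmoothBridge C D P) :
    B.toScalarBridge.pl = B.pl ∧ B.toScalarBridge.w = B.w := ⟨rfl, rfl⟩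

/-- The D7-free chart from the Fréchet-smooth bridge. -/
def toOrbitCore (B : FockSmoothBridge C D P) : OrbitCore C P := B.toScalarBridge.toOrbitCore

/-- (Ported verbatim from the HodgeCMPerL package; no docstring in the source.) -/
theorem toOrbitCore_eigen_iff (B : FockSmoothBridge C D P) (i : SigIdx) :
    B.toOrbitCore.Eigen i ↔ ∃ y ∈ C.hatσ i, y ≠ 0 ∧ ∀ t : B.pl.Tg, C.R (B.ιT t) y = B.w t • y := Iff.rfl

/-- **Lemma 4.1(c) over the Fréchet-smooth bridge**: [SETUP D5′] (ω-side smooth vector) in place of `hF`, no D7,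
everything else kernel / [D4] / [DEFINITIONAL]. -/
theorem H_occ (B : FockSmoothBridge C D P) :
    ∀ (Φ : SK) (i : SigIdx), (∃ v ∈ C.hatσ i, C.TΦ Φ v ≠ 0) → D.wOccurs i :=
  B.toScalarBridge.H_occ

end FockSmoothBridge

/-- **The S4 input over the PRINTED places, scalar form** = `PrintedOrbitSide` with `hF` replaced by `hFpt`. -/
structure PrintedScalarSide (C : IsolationCore H HG CG G SK SigIdx SigIdxG) (D : TorusData C)
    (P : C4a.PointedCore C) (RP : Type) [Fintype RP] [DecidableEq RP] (kind : RP → PlaceKind)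
    (lam : RP → ℂ) (hlam : ∀ b, lam b ≠ 0) (vac : RP → (Circle × Circle →* Circle)) where
  /-- [SETUP D4] T(L₀⊗ℝ) = ∏_b T_b ⊂ U(W)(𝔸) = `G`. -/
  ιT : (printPlaces RP kind lam hlam vac).Tg →* G
  /-- [SETUP D4] the additive group structure of 𝒮^κ. -/
  [instSKacg : AddCommGroup SK]
  /-- [SETUP D4] the ℂ-vector-space structure of 𝒮^κ. -/
  [instSKmod : Module ℂ SK]
  /-- [SETUP D4] Φ ↦ 𝒯_Φ is additive. -/
  TΦc_add : ∀ Φ Ψ : SK, C.TΦc (Φ + Ψ) = C.TΦc Φ + C.TΦc Ψ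
  /-- [SETUP D4] Φ ↦ 𝒯_Φ is homogeneous. -/
  TΦc_smul : ∀ (c : ℂ) (Φ : SK), C.TΦc (c • Φ) = c • C.TΦc Φ
  /-- [SETUP D4] Φ ↦ 𝒯_Φ(v)(g) is continuous on 𝒮^κ. -/
  cont : ∀ (p : P.Pt) (v : H), Continuous fun Φ : SK => P.evalPt p (C.TΦc Φ v)
  /-- [SETUP D4] index of the fixed finite data Φ_f. -/
  FinIdx : Type
  /-- [SETUP D4] φ ↦ φ ⊗ Φ_f, linear. -/
  ins : FinIdx → (printPlaces RP kind lam hlam vac).F →ₗ[ℂ] SK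
  /-- [SETUP D4/D5] the pure tensors span a dense subspace of 𝒮^κ. -/
  dense : Dense (Submodule.span ℂ
    (Set.range fun q : FinIdx × (printPlaces RP kind lam hlam vac).F => ins q.1 q.2) : Set SK)
  /-- [SETUP D4] ω(t)(φ ⊗ Φ_f) = (ω_∞(t)φ) ⊗ Φ_f. -/
  omg_ins : ∀ (f : FinIdx) (t : (printPlaces RP kind lam hlam vac).Tg) (φ : (printPlaces RP kind lam hlam vac).F),
    C.omg (ιT t) (ins f φ) = ins f ((printPlaces RP kind lam hlam vac).ωT t φ)
  /-- [NODE N21] 𝒯_{ω(h)Φ}(R(h)v) = 𝒯_Φ(v). -/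
  invariance : ∀ (h : G) (Φ : SK) (v : H), C.TΦc (C.omg h Φ) (C.R h v) = C.TΦc Φ v
  /-- [SETUP D5] index of a family of real directions. -/
  ιR : Type
  /-- [SETUP D5] ω_∞(X_j) on 𝓕^κ_∞. -/
  XR : ιR → (printPlaces RP kind lam hlam vac).F →ₗ[ℂ] (printPlaces RP kind lam hlam vac).F
  /-- [SETUP D4] the curves e_j. -/
  e : ιR → ℝ → G
  /-- [SETUP D5] ladder operators are complex combinations of the real directions. -/
  ladder_span : ∀ k : (printPlaces RP kind lam hlam vac).ιX,
    (printPlaces RP kind lam hlam vac).X k ∈ Submodule.span ℂ (Set.range XR)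
  /-- [SETUP D5, scalar shadow] (verbatim `FockScalarBridge.hFpt`). -/
  hFpt : ∀ (j : ιR) (f : FinIdx) (φ : (printPlaces RP kind lam hlam vac).F) (p : P.Pt) (v : H),
    HasDerivAt (fun s : ℝ => P.evalPt p (C.TΦc (C.omg (e j s) (ins f φ)) v))
      (P.evalPt p (C.TΦc (ins f (XR j φ)) v)) 0
  /-- [DEFINITIONAL] meaning of `TorusData.wOccurs`, with the printed `w`. -/
  wOccurs_of_eigenvector : ∀ i : SigIdx,
    (∃ y ∈ C.hatσ i, y ≠ 0 ∧ ∀ t : (printPlaces RP kind lam hlam vac).Tg,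
      C.R (ιT t) y = printPlacesW RP kind lam hlam vac t • y) → D.wOccurs i

/-- **The S4 input over the PRINTED places, Fréchet-smooth form** = `PrintedOrbitSide` with `hF` replaced by `smooth`. -/
structure PrintedSmoothSide (C : IsolationCore H HG CG G SK SigIdx SigIdxG) (D : TorusData C)
    (P : C4a.PointedCore C) (RP : Type) [Fintype RP] [DecidableEq RP] (kind : RP → PlaceKind)
    (lam : RP → ℂ) (hlam : ∀ b, lam b ≠ 0) (vac : RP → (Circle × Circle →* Circle)) where
  /-- [SETUP D4] T(L₀⊗ℝ) = ∏_b T_b ⊂ U(W)(𝔸) = `G`. -/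
  ιT : (printPlaces RP kind lam hlam vac).Tg →* G
  /-- [SETUP D4] the additive group structure of 𝒮^κ. -/
  [instSKacg : AddCommGroup SK]
  /-- [SETUP D4] the ℂ-vector-space structure of 𝒮^κ. -/
  [instSKmod : Module ℂ SK]
  /-- [SETUP D4] Φ ↦ 𝒯_Φ is additive. -/
  TΦc_add : ∀ Φ Ψ : SK, C.TΦc (Φ + Ψ) = C.TΦc Φ + C.TΦc Ψ
  /-- [SETUP D4] Φ ↦ 𝒯_Φ is homogeneous. -/
  TΦc_smul : ∀ (c : ℂ) (Φ : SK), C.TΦc (c • Φ) = c • C.TΦc Φ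
  /-- [SETUP D4] Φ ↦ 𝒯_Φ(v)(g) is continuous on 𝒮^κ. -/
  cont : ∀ (p : P.Pt) (v : H), Continuous fun Φ : SK => P.evalPt p (C.TΦc Φ v)
  /-- [SETUP D4] index of the fixed finite data Φ_f. -/
  FinIdx : Type
  /-- [SETUP D4] φ ↦ φ ⊗ Φ_f, linear. -/
  ins : FinIdx → (printPlaces RP kind lam hlam vac).F →ₗ[ℂ] SK
  /-- [SETUP D4/D5] the pure tensors span a dense subspace of 𝒮^κ. -/
  dense : Dense (Submodule.span ℂ
    (Set.range fun q : FinIdx × (printPlaces RP kind lam hlam vac).F => ins q.1 q.2) : Set SK)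
  /-- [SETUP D4] ω(t)(φ ⊗ Φ_f) = (ω_∞(t)φ) ⊗ Φ_f. -/
  omg_ins : ∀ (f : FinIdx) (t : (printPlaces RP kind lam hlam vac).Tg) (φ : (printPlaces RP kind lam hlam vac).F),
    C.omg (ιT t) (ins f φ) = ins f ((printPlaces RP kind lam hlam vac).ωT t φ)
  /-- [NODE N21] 𝒯_{ω(h)Φ}(R(h)v) = 𝒯_Φ(v). -/
  invariance : ∀ (h : G) (Φ : SK) (v : H), C.TΦc (C.omg h Φ) (C.R h v) = C.TΦc Φ v
  /-- [SETUP D5] index of a family of real directions. -/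
  ιR : Type
  /-- [SETUP D5] ω_∞(X_j) on 𝓕^κ_∞. -/
  XR : ιR → (printPlaces RP kind lam hlam vac).F →ₗ[ℂ] (printPlaces RP kind lam hlam vac).F
  /-- [SETUP D4] the curves e_j. -/
  e : ιR → ℝ → G
  /-- [SETUP D5] ladder operators are complex combinations of the real directions. -/
  ladder_span : ∀ k : (printPlaces RP kind lam hlam vac).ιX,
    (printPlaces RP kind lam hlam vac).X k ∈ Submodule.span ℂ (Set.range XR)
  /-- [SETUP D5′, FRÉCHET-SMOOTH VECTOR] (verbatim `FockSmoothBridge.smooth`; print warrant and locator as there). -/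
  smooth : ∀ (j : ιR) (f : FinIdx) (φ : (printPlaces RP kind lam hlam vac).F),
    Tendsto (fun s : ℝ => ((s : ℝ) : ℂ)⁻¹ • (C.omg (e j s) (ins f φ) - C.omg (e j 0) (ins f φ)))
      (𝓝[≠] 0) (𝓝 (ins f (XR j φ)))
  /-- [DEFINITIONAL] meaning of `TorusData.wOccurs`, with the printed `w`. -/
  wOccurs_of_eigenvector : ∀ i : SigIdx,
    (∃ y ∈ C.hatσ i, y ≠ 0 ∧ ∀ t : (printPlaces RP kind lam hlam vac).Tg,
      C.R (ιT t) y = printPlacesW RP kind lam hlam vac t • y) → D.wOccurs i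

section Printed

variable {C : IsolationCore H HG CG G SK SigIdx SigIdxG} {D : TorusData C} {P : C4a.PointedCore C}
variable {RP : Type} [Fintype RP] [DecidableEq RP] {kind : RP → PlaceKind} {lam : RP → ℂ} {hlam : ∀ b, lam b ≠ 0}
  {vac : RP → (Circle × Circle →* Circle)}

/-- The scalar bridge from the printed scalar side (`pl := printPlaces`, `w := printPlacesW`). -/
def PrintedScalarSide.toScalarBridge (A : PrintedScalarSide C D P RP kind lam hlam vac) : FockScalarBridge C D P :=
  letI : AddCommGroup SK := A.instSKacg
  letI : Module ℂ SK := A.instSKmod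
  { pl := printPlaces RP kind lam hlam vac
    ιT := A.ιT
    w := printPlacesW RP kind lam hlam vac
    w_norm := printPlacesW_norm RP kind lam hlam vac
    w_loc := printPlacesW_loc RP kind lam hlam vac
    instSKacg := A.instSKacg
    instSKmod := A.instSKmod
    TΦc_add := A.TΦc_add
    TΦc_smul := A.TΦc_smul
    cont := A.cont
    FinIdx := A.FinIdx
    ins := A.ins
    dense := A.dense
    omg_ins := A.omg_ins
    invariance := A.invariance
    ιR := A.ιR
    XR := A.XR
    e := A.e
    ladder_span := A.ladder_span
    hFpt := A.hFpt
    wOccurs_of_eigenvector := A.wOccurs_of_eigenvector }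

/-- (Ported verbatim from the HodgeCMPerL package; no docstring in the source.) -/
theorem PrintedScalarSide.toScalarBridge_pl (A : PrintedScalarSide C D P RP kind lam hlam vac) :
    A.toScalarBridge.pl = printPlaces RP kind lam hlam vac ∧
      A.toScalarBridge.w = printPlacesW RP kind lam hlam vac := ⟨rfl, rfl⟩

/-- **Lemma 4.1(c) over the printed places, scalar form.** -/
theorem PrintedScalarSide.H_occ (A : PrintedScalarSide C D P RP kind lam hlam vac) :
    ∀ (Φ : SK) (i : SigIdx), (∃ v ∈ C.hatσ i, C.TΦ Φ v ≠ 0) → D.wOccurs i :=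
  A.toScalarBridge.H_occ

/-- Printed orbit side ⇒ printed scalar side. -/
def PrintedScalarSide.ofOrbit (A : PrintedOrbitSide C D P RP kind lam hlam vac) :
    PrintedScalarSide C D P RP kind lam hlam vac where
  ιT := A.ιT
  instSKacg := A.instSKacg
  instSKmod := A.instSKmod
  TΦc_add := A.TΦc_add
  TΦc_smul := A.TΦc_smul
  cont := A.cont
  FinIdx := A.FinIdx
  ins := A.ins
  dense := A.dense
  omg_ins := A.omg_ins
  invariance := A.invariance
  ιR := A.ιR
  XR := A.XR
  e := A.e
  ladder_span := A.ladder_span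
  hFpt := fun j f φ p v => hasDerivAt_pointValue_of_hasDerivAt (A.e j) (A.hF j f φ p) v
  wOccurs_of_eigenvector := A.wOccurs_of_eigenvector

/-- The Fréchet-smooth bridge from the printed-places smooth side. -/
def PrintedSmoothSide.toSmoothBridge (A : PrintedSmoothSide C D P RP kind lam hlam vac) : FockSmoothBridge C D P :=
  letI : AddCommGroup SK := A.instSKacg
  letI : Module ℂ SK := A.instSKmod
  { pl := printPlaces RP kind lam hlam vac
    ιT := A.ιT
    w := printPlacesW RP kind lam hlam vac
    w_norm := printPlacesW_norm RP kind lam hlam vac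
    w_loc := printPlacesW_loc RP kind lam hlam vac
    instSKacg := A.instSKacg
    instSKmod := A.instSKmod
    TΦc_add := A.TΦc_add
    TΦc_smul := A.TΦc_smul
    cont := A.cont
    FinIdx := A.FinIdx
    ins := A.ins
    dense := A.dense
    omg_ins := A.omg_ins
    invariance := A.invariance
    ιR := A.ιR
    XR := A.XR
    e := A.e
    ladder_span := A.ladder_span
    smooth := A.smooth
    wOccurs_of_eigenvector := A.wOccurs_of_eigenvector }

/-- (Ported verbatim from the HodgeCMPerL package; no docstring in the source.) -/
theorem PrintedSmoothSide.toSmoothBridge_pl (A : PrintedSmoothSide C D P RP kind lam hlam vac) :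
    A.toSmoothBridge.pl = printPlaces RP kind lam hlam vac ∧
      A.toSmoothBridge.w = printPlacesW RP kind lam hlam vac := ⟨rfl, rfl⟩

/-- The printed scalar side from the printed smooth side (KERNEL, `hasDerivAt_pointValue_of_tendsto_slope`). -/
def PrintedSmoothSide.toScalarSide (A : PrintedSmoothSide C D P RP kind lam hlam vac) :
    PrintedScalarSide C D P RP kind lam hlam vac :=
  letI : AddCommGroup SK := A.instSKacg
  letI : Module ℂ SK := A.instSKmod
  { ιT := A.ιT
    instSKacg := A.instSKacg
    instSKmod := A.instSKmod
    TΦc_add := A.TΦc_add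
    TΦc_smul := A.TΦc_smul
    cont := A.cont
    FinIdx := A.FinIdx
    ins := A.ins
    dense := A.dense
    omg_ins := A.omg_ins
    invariance := A.invariance
    ιR := A.ιR
    XR := A.XR
    e := A.e
    ladder_span := A.ladder_span
    hFpt := fun j f φ p v =>
      hasDerivAt_pointValue_of_tendsto_slope A.TΦc_add A.TΦc_smul A.cont
        (γ := fun s => C.omg (A.e j s) (A.ins f φ)) (A.smooth j f φ) p v
    wOccurs_of_eigenvector := A.wOccurs_of_eigenvector }

/-- **Lemma 4.1(c) over the printed places, with [SETUP D5′] (Fréchet-smooth vector, ω-side) in place of `hF` and no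
[SETUP D7].** -/
theorem PrintedSmoothSide.H_occ (A : PrintedSmoothSide C D P RP kind lam hlam vac) :
    ∀ (Φ : SK) (i : SigIdx), (∃ v ∈ C.hatσ i, C.TΦ Φ v ≠ 0) → D.wOccurs i :=
  A.toSmoothBridge.H_occ

end Printed

end Bridge

end ArchC

/-! ## §3  The model-level corollaries BY NAME -/

section Model

open HodgeCM.Prior.Perl34File HodgeCM.Prior.Perl34File.Perl34 HodgeCM.PerL34.ArchC

variable {U : Universe}

/-- **`Open_occ` from scalar bridges in every good context** (the weakest typed analytic S4 input). -/
theorem Open_occ_of_fockScalarBridges (T : U.ThetaModel)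
    (Pc : ∀ {L : CMField} {ι₁ : L →+* ℂ} (V : HermSpace3 L ι₁) (c : SeesawCtx L),
      C4a.PointedCore (T.core V c))
    (B12 : ∀ {L : CMField} {ι₁ : L →+* ℂ} (V : HermSpace3 L ι₁) (c : SeesawCtx L),
      T.GoodCtx ι₁ c → Nonempty (FockScalarBridge (T.core V c) (T.t12 V c) (Pc V c)))
    (B34 : ∀ {L : CMField} {ι₁ : L →+* ℂ} (V : HermSpace3 L ι₁) (c : SeesawCtx L),
      T.GoodCtx ι₁ c → Nonempty (FockScalarBridge (T.core V c) (T.t34 V c) (Pc V c))) :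
    T.Open_occ := by
  intro L ι₁ V c hc
  obtain ⟨a⟩ := B12 V c hc
  obtain ⟨b⟩ := B34 V c hc
  exact ⟨a.H_occ, b.H_occ⟩

/-- **`Open_occ` from Fréchet-smooth bridges in every good context**: node N29 with the last analytic dictionary entry
as a statement about ω alone (Fock vectors are Fréchet-smooth vectors of ω, [SETUP D5′]) and without the Gårding package. -/
theorem Open_occ_of_fockSmoothBridges (T : U.ThetaModel)
    (Pc : ∀ {L : CMField} {ι₁ : L →+* ℂ} (V : HermSpace3 L ι₁) (c : SeesawCtx L),
      C4a.PointedCore (T.core V c))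
    (B12 : ∀ {L : CMField} {ι₁ : L →+* ℂ} (V : HermSpace3 L ι₁) (c : SeesawCtx L),
      T.GoodCtx ι₁ c → Nonempty (FockSmoothBridge (T.core V c) (T.t12 V c) (Pc V c)))
    (B34 : ∀ {L : CMField} {ι₁ : L →+* ℂ} (V : HermSpace3 L ι₁) (c : SeesawCtx L),
      T.GoodCtx ι₁ c → Nonempty (FockSmoothBridge (T.core V c) (T.t34 V c) (Pc V c))) :
    T.Open_occ :=
  Open_occ_of_fockScalarBridges T Pc (fun V c hc => (B12 V c hc).map FockSmoothBridge.toScalarBridge)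
    (fun V c hc => (B34 V c hc).map FockSmoothBridge.toScalarBridge)

/-- **N29 BY NAME from Fréchet-smooth bridges** (carver `N29_occ`). -/
theorem N29_occ_of_fockSmoothBridges (T : U.ThetaModel)
    (Pc : ∀ {L : CMField} {ι₁ : L →+* ℂ} (V : HermSpace3 L ι₁) (c : SeesawCtx L),
      C4a.PointedCore (T.core V c))
    (B12 : ∀ {L : CMField} {ι₁ : L →+* ℂ} (V : HermSpace3 L ι₁) (c : SeesawCtx L),
      T.GoodCtx ι₁ c → Nonempty (FockSmoothBridge (T.core V c) (T.t12 V c) (Pc V c)))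
    (B34 : ∀ {L : CMField} {ι₁ : L →+* ℂ} (V : HermSpace3 L ι₁) (c : SeesawCtx L),
      T.GoodCtx ι₁ c → Nonempty (FockSmoothBridge (T.core V c) (T.t34 V c) (Pc V c))) :
    N29_occ T :=
  (N29_iff T).mpr (Open_occ_of_fockSmoothBridges T Pc B12 B34)

/-- The orbit bridges feed the scalar theorem (forgetfully): the operator-norm input implies the scalar input. -/
theorem Open_occ_of_fockOrbitBridges_viaScalar (T : U.ThetaModel)
    (Pc : ∀ {L : CMField} {ι₁ : L →+* ℂ} (V : HermSpace3 L ι₁) (c : SeesawCtx L),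
      C4a.PointedCore (T.core V c))
    (B12 : ∀ {L : CMField} {ι₁ : L →+* ℂ} (V : HermSpace3 L ι₁) (c : SeesawCtx L),
      T.GoodCtx ι₁ c → Nonempty (FockOrbitBridge (T.core V c) (T.t12 V c) (Pc V c)))
    (B34 : ∀ {L : CMField} {ι₁ : L →+* ℂ} (V : HermSpace3 L ι₁) (c : SeesawCtx L),
      T.GoodCtx ι₁ c → Nonempty (FockOrbitBridge (T.core V c) (T.t34 V c) (Pc V c))) :
    T.Open_occ :=
  Open_occ_of_fockScalarBridges T Pc (fun V c hc => (B12 V c hc).map FockScalarBridge.ofOrbit)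
    (fun V c hc => (B34 V c hc).map FockScalarBridge.ofOrbit)

end Model

end PerL34
end HodgeCM

end
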